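import Literature.NumberTheory.GaloisRepresentations.BrauerTower
import Literature.NumberTheory.GaloisRepresentations.BrauerTowerBound
import Literature.NumberTheory.GaloisRepresentations.LocalDualityTheorem
import Literature.AlgebraicGeometry.Frobenioids.KummerCupProductFN
import HarnessLib

/-!
# Frobenioids II, Def. 2.2 (ii) p. 18: local Tate duality in the adjoint "power-pairing" form
# `H¹(Γ, μ_N) ⥲ Hom(H¹(Γ, ℤ/N), H²(Γ, μ_N))`, and its transport along isomorphisms of the data

Mochizuki, *The geometry of Frobenioids II*, Kyushu J. Math. **62** (2008), §2, Def. 2.2 (ii) p. 18: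
"by the well-known duality theory of nonarchimedean [mixed-characteristic] local fields [cf., e.g.,
[NSW], Chapter 7, Theorem 7.2.6], the cup product on group cohomology determines an isomorphism
`H¹(H, μ_N(A)) ⥲ H^{ab} ⊗ H²(H, μ_N(A))`" [cite: MochizukiFrdII2008, Def 2.2 (ii) p.18].

Cell abc-iut, row L1-γ₁, milestone M4 (ii) second half (seat abc-iut-w5-d207, after
abc-iut-L2-t12's `KummerCupDualTransport.lean` and its `M4ii-PLAN.md`): the one residual input of
the cup-product construction of the [FrdII] duality isomorphism (`Kummer.dualityIsoOfCupProduct`,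
`Kummer.cupDual_bijective_of_isCohSaturated`) is `hH : Bijective (Kummer.cupDualH …)` — local Tate
duality for the profinite group `H` in ADJOINT form for the pairing `μ_N × ℤ/N → μ_N`,
`(ζ, k) ↦ ζᵏ`. This file supplies the two GROUP-THEORETIC halves of that input:

* §1 `ContinuousCohomology.map_bijective_of_inverse`, `ContPairing.cupAdjoint_bijective_iff` — the
  adjoint `a ↦ (b ↦ a ∪ b)` of a cup product is bijective iff it is so after transport along a
  continuous isomorphism of groups `θ : H ≃ G` together with compatible isomorphisms of the three
  coefficient modules (naturality of the cup product, abc-iut-L2-t12's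
  `ContPairing.cupProduct_map_pair`, plus `map_comp_apply_of` / `map_apply_of_id`);
* §2 `ContPairing.powPairing` — the pairing `X × ℤ/n → X`, `(x, k) ↦ k • x` for a discrete
  `G`-module `X` killed by `n`; `powAdjoint_bijective_local` — **for a non-archimedean local field
  `F` of characteristic `0`, `a ↦ (b ↦ a ∪ b) : H¹(Γ_F, μ_n) → Hom(H¹(Γ_F, ℤ/n), H²(Γ_F, μ_n))`
  is bijective**, deduced from the trunk's local Tate duality `localDuality_bijective` (Serre,
  *Galois Cohomology* II §5.2 Thm. 2, with `M = ℤ/n`, `M^D = Hom(ℤ/n, μ_n) ≅ μ_n`) by the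
  coefficient isomorphism `f ↦ f 1`, graded commutativity `cupProduct_comm` (the sign is
  immaterial) and the injectivity of the invariant map `ι : H²(Γ_F, μ_n) ↪ ℤ/n`.

The binding `H = X.H` of a Definition 2.2 context at `Def22Context.ofGalois` is the companion
file `KummerLocalDualityBinding.lean`. Classical; nothing here concerns [IUTchIII].
-/

noncomputable section

open CategoryTheory Function

namespace Literature.NumberTheory.GaloisRepresentations

open _root_.TopRep _root_.ContRepresentation _root_.ContinuousCohomology

universe u

/-! ### §0 An algebraic lemma: bijectivity of `A → Hom(B, C)` is invariant under isomorphisms -/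

/-- If `e₃ (F a b) = F' (e₁ a) (e₂ b)` for additive isomorphisms `e₁, e₂, e₃`, then `F` is
bijective iff `F'` is. [folklore] -/
private theorem bijective_adjoint_iff_of_addEquiv {A A' B B' C C' : Type*} [AddCommGroup A]
    [AddCommGroup A'] [AddCommGroup B] [AddCommGroup B'] [AddCommGroup C] [AddCommGroup C']
    (e₁ : A ≃+ A') (e₂ : B ≃+ B') (e₃ : C ≃+ C') (F : A → (B →+ C)) (F' : A' → (B' →+ C'))
    (h : ∀ a b, e₃ (F a b) = F' (e₁ a) (e₂ b)) : Bijective F ↔ Bijective F' := by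
  -- `Φ φ := e₃ ∘ φ ∘ e₂⁻¹` is a bijection `Hom(B, C) ≃ Hom(B', C')` with `F' ∘ e₁ = Φ ∘ F`
  let Φ : (B →+ C) → (B' →+ C') := fun φ =>
    e₃.toAddMonoidHom.comp (φ.comp e₂.symm.toAddMonoidHom)
  let Ψ : (B' →+ C') → (B →+ C) := fun ψ =>
    e₃.symm.toAddMonoidHom.comp (ψ.comp e₂.toAddMonoidHom)
  have hΦ : Bijective Φ := by
    refine Function.bijective_iff_has_inverse.2 ⟨Ψ, fun φ => ?_, fun ψ => ?_⟩
    · ext b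
      change e₃.symm (e₃ (φ (e₂.symm (e₂ b)))) = φ b
      rw [e₂.symm_apply_apply, e₃.symm_apply_apply]
    · ext b'
      change e₃ (e₃.symm (ψ (e₂ (e₂.symm b')))) = ψ b'
      rw [e₂.apply_symm_apply, e₃.apply_symm_apply]
  have hcomp : F' ∘ e₁ = Φ ∘ F := by
    funext a
    ext b'
    change F' (e₁ a) b' = e₃ (F a (e₂.symm b'))
    rw [h, e₂.apply_symm_apply]
  constructor
  · intro hF
    have h2 : Bijective (F' ∘ e₁) := by rw [hcomp]; exact hΦ.comp hF
    exact (Bijective.of_comp_iff F' e₁.bijective).1 h2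
  · intro hF'
    have h2 : Bijective (Φ ∘ F) := by rw [← hcomp]; exact hF'.comp e₁.bijective
    exact (Bijective.of_comp_iff' hΦ F).1 h2

/-! ### §1 Transport of cohomology and of the adjoint cup product along an isomorphism pair -/

section Transport

variable {G : Type u} [Group G] [TopologicalSpace G] [IsTopologicalGroup G]
variable {H : Type u} [Group H] [TopologicalSpace H] [IsTopologicalGroup H]

/-- The composite `res (θ ∘ θ') X ⟶ X` of a pair `f : res θ X ⟶ Y`, `f' : res θ' Y ⟶ X`, as a
morphism of topological `G`-representations (on vectors `v ↦ f' (f v)`). [folklore] -/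
def resCompHom {X : TopRep.{u} ℤ G} {Y : TopRep.{u} ℤ H} (θ : H →ₜ* G) (θ' : G →ₜ* H)
    (f : TopRep.res (θ : H →* G) X ⟶ Y) (f' : TopRep.res (θ' : G →* H) Y ⟶ X) :
    TopRep.res ((θ.comp θ' : G →ₜ* G) : G →* G) X ⟶ X :=
  (TopRep.resFunctor (θ' : G →* H)).map f ≫ f'

omit [IsTopologicalGroup G] [IsTopologicalGroup H] in
/-- Unfolding `resCompHom`. [folklore] -/
@[simp] private theorem resCompHom_hom_apply {X : TopRep.{u} ℤ G} {Y : TopRep.{u} ℤ H} (θ : H →ₜ* G)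
    (θ' : G →ₜ* H) (f : TopRep.res (θ : H →* G) X ⟶ Y) (f' : TopRep.res (θ' : G →* H) Y ⟶ X)
    (v : X) : (resCompHom θ θ' f f').hom v = f'.hom (f.hom v) := rfl

/-- **Transport of continuous cohomology along an isomorphism pair**: if `θ : H → G`,
`θ' : G → H` are mutually inverse continuous homomorphisms and `f : res θ X ⟶ Y`,
`f' : res θ' Y ⟶ X` are mutually inverse on vectors, then `Hⁿ(θ, f) : Hⁿ(G, X) → Hⁿ(H, Y)` is
bijective (with inverse `Hⁿ(θ', f')`; functoriality `map_comp_apply_of`, `map_apply_of_id`).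
[cite: SerreGaloisCohomology1997, I §2.4] -/
theorem map_leftInverse_of_inverse {X : TopRep.{u} ℤ G} {Y : TopRep.{u} ℤ H}
    (θ : H →ₜ* G) (θ' : G →ₜ* H) (hθ' : ∀ g, θ (θ' g) = g)
    (f : TopRep.res (θ : H →* G) X ⟶ Y) (f' : TopRep.res (θ' : G →* H) Y ⟶ X)
    (hf : ∀ x, f'.hom (f.hom x) = x) (n : ℕ) (z : continuousCohomology n X) :
    ContinuousCohomology.map θ' f' n (ContinuousCohomology.map θ f n z) = z := by
  rw [← map_comp_apply_of θ θ' (θ.comp θ') (fun _ => rfl) f f' (resCompHom θ θ' f f')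
    (fun _ => rfl) n z]
  exact map_apply_of_id (θ.comp θ') hθ' (resCompHom θ θ' f f') hf n z

/-- **`Hⁿ(θ, f)` is bijective** for an isomorphism pair as in `map_leftInverse_of_inverse`.
[cite: SerreGaloisCohomology1997, I §2.4] -/
theorem map_bijective_of_inverse {X : TopRep.{u} ℤ G} {Y : TopRep.{u} ℤ H}
    (θ : H →ₜ* G) (θ' : G →ₜ* H) (hθ : ∀ h, θ' (θ h) = h) (hθ' : ∀ g, θ (θ' g) = g)
    (f : TopRep.res (θ : H →* G) X ⟶ Y) (f' : TopRep.res (θ' : G →* H) Y ⟶ X)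
    (hf : ∀ x, f'.hom (f.hom x) = x) (hf' : ∀ y, f.hom (f'.hom y) = y) (n : ℕ) :
    Bijective (ContinuousCohomology.map θ f n) :=
  Function.bijective_iff_has_inverse.2 ⟨ContinuousCohomology.map θ' f' n,
    fun z => map_leftInverse_of_inverse θ θ' hθ' f f' hf n z,
    fun w => map_leftInverse_of_inverse θ' θ hθ f' f hf' n w⟩

/-- `Hⁿ(θ, f)` as an additive isomorphism, for an isomorphism pair. [folklore] -/
def mapAddEquivOfInverse {X : TopRep.{u} ℤ G} {Y : TopRep.{u} ℤ H}
    (θ : H →ₜ* G) (θ' : G →ₜ* H) (hθ : ∀ h, θ' (θ h) = h) (hθ' : ∀ g, θ (θ' g) = g)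
    (f : TopRep.res (θ : H →* G) X ⟶ Y) (f' : TopRep.res (θ' : G →* H) Y ⟶ X)
    (hf : ∀ x, f'.hom (f.hom x) = x) (hf' : ∀ y, f.hom (f'.hom y) = y) (n : ℕ) :
    continuousCohomology n X ≃+ continuousCohomology n Y :=
  AddEquiv.ofBijective (ContinuousCohomology.map θ f n).hom.toLinearMap.toAddMonoidHom
    (map_bijective_of_inverse θ θ' hθ hθ' f f' hf hf' n)

/-- Unfolding `mapAddEquivOfInverse`: it is `Hⁿ(θ, f)`. [cite: SerreGaloisCohomology1997, I §2.4] -/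
@[simp] theorem mapAddEquivOfInverse_apply {X : TopRep.{u} ℤ G} {Y : TopRep.{u} ℤ H}
    (θ : H →ₜ* G) (θ' : G →ₜ* H) (hθ : ∀ h, θ' (θ h) = h) (hθ' : ∀ g, θ (θ' g) = g)
    (f : TopRep.res (θ : H →* G) X ⟶ Y) (f' : TopRep.res (θ' : G →* H) Y ⟶ X)
    (hf : ∀ x, f'.hom (f.hom x) = x) (hf' : ∀ y, f.hom (f'.hom y) = y) (n : ℕ)
    (z : continuousCohomology n X) :
    mapAddEquivOfInverse θ θ' hθ hθ' f f' hf hf' n z = ContinuousCohomology.map θ f n z := rfl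

variable [LocallyCompactSpace G] [LocallyCompactSpace H]

/-- **Transport of the adjoint cup product**: for pairings `P : X × Y → Z` of `G`-modules and
`P' : X' × Y' → Z'` of `H`-modules, an isomorphism pair `(θ, θ')` of the groups and compatible
isomorphism pairs of the coefficient modules with `γ⟨x, y⟩ = ⟨α x, β y⟩'`, the adjoint
`a ↦ (b ↦ a ∪ b)` of `P` is bijective iff that of `P'` is.
[cite: NeukirchSchmidtWingberg2008, I §4 (1.4.2)] -/
theorem ContPairing.cupAdjoint_bijective_iff
    {X Y Z : TopRep.{u} ℤ G} {X' Y' Z' : TopRep.{u} ℤ H} (P : ContPairing X Y Z)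
    (P' : ContPairing X' Y' Z')
    (θ : H →ₜ* G) (θ' : G →ₜ* H) (hθ : ∀ h, θ' (θ h) = h) (hθ' : ∀ g, θ (θ' g) = g)
    (α : TopRep.res (θ : H →* G) X ⟶ X') (α' : TopRep.res (θ' : G →* H) X' ⟶ X)
    (hα : ∀ x, α'.hom (α.hom x) = x) (hα' : ∀ x', α.hom (α'.hom x') = x')
    (β : TopRep.res (θ : H →* G) Y ⟶ Y') (β' : TopRep.res (θ' : G →* H) Y' ⟶ Y)
    (hβ : ∀ y, β'.hom (β.hom y) = y) (hβ' : ∀ y', β.hom (β'.hom y') = y')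
    (γ : TopRep.res (θ : H →* G) Z ⟶ Z') (γ' : TopRep.res (θ' : G →* H) Z' ⟶ Z)
    (hγ : ∀ z, γ'.hom (γ.hom z) = z) (hγ' : ∀ z', γ.hom (γ'.hom z') = z')
    (hc : ∀ x y, γ.hom (P.toLin x y) = P'.toLin (α.hom x) (β.hom y)) :
    Bijective (fun a => (P.cupProduct a).toAddMonoidHom) ↔
      Bijective (fun a' => (P'.cupProduct a').toAddMonoidHom) :=
  bijective_adjoint_iff_of_addEquiv (mapAddEquivOfInverse θ θ' hθ hθ' α α' hα hα' 1)
    (mapAddEquivOfInverse θ θ' hθ hθ' β β' hβ hβ' 1) (mapAddEquivOfInverse θ θ' hθ hθ' γ γ' hγ hγ' 2)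
    _ _ fun a b => by
      rw [mapAddEquivOfInverse_apply, mapAddEquivOfInverse_apply, mapAddEquivOfInverse_apply]
      exact ContPairing.cupProduct_map_pair θ P P' α β γ hc a b

end Transport

/-! ### §2 The power pairing `M × ℤ/n → M` and local duality in adjoint form -/

section Pow

variable {G : Type} [Group G] [TopologicalSpace G] [IsTopologicalGroup G]
variable (n : ℕ) {M : Type} [AddCommGroup M] [TopologicalSpace M] [DiscreteTopology M]

/-- **The pairing `M × ℤ/n → M`, `(x, k) ↦ k • x`** for a discrete `G`-module `M` killed by `n`
(the `ℤ/n`-module structure `AddCommGroup.zmodModule`), `ℤ/n` with the trivial action — the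
coefficient pairing `μ_N(A) × ℤ/Nℤ → μ_N(A)`, `(ζ, k) ↦ ζᵏ`, of FrdII p. 18 (cf.
`Kummer.muPowPairing`). [cite: MochizukiFrdII2008, Def 2.2 (ii) p.18] -/
def ContPairing.powPairing (ρ : ContinuousRep G ℤ M) (hM : ∀ x : M, n • x = 0) :
    ContPairing ρ.toTopRep (ContinuousRep.trivial G ℤ (ZMod n)).toTopRep ρ.toTopRep :=
  letI : Module (ZMod n) M := AddCommGroup.zmodModule hM
  haveI : DiscreteTopology (ContinuousRep.trivial G ℤ (ZMod n)).toTopRep :=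
    inferInstanceAs (DiscreteTopology (ZMod n))
  haveI : DiscreteTopology ρ.toTopRep := inferInstanceAs (DiscreteTopology M)
  ContPairing.ofDiscrete
    (LinearMap.mk₂ ℤ (fun (x : M) (k : ZMod n) => (k • x : M))
      (fun x x' k => smul_add k x x')
      (fun c x k => by
        change k • (zsmulAddGroupHom c : M →+ M) x = (zsmulAddGroupHom c : M →+ M) (k • x)
        exact (ZMod.map_smul (zsmulAddGroupHom c : M →+ M) k x).symm)
      (fun x k k' => add_smul k k' x)
      (fun c x k => by
        change ((c • k : ZMod n)) • x = (zsmulAddGroupHom c : M →+ M) (k • x)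
        rw [zsmulAddGroupHom_apply, zsmul_eq_mul, mul_smul, Int.cast_smul_eq_zsmul]))
    fun g x k => by
      change ((ContinuousRep.trivial G ℤ (ZMod n)) g k) • ρ g x = ρ g (k • x)
      rw [ContinuousRep.trivial_apply]
      exact (ZMod.map_smul (ρ g).toAddMonoidHom k x).symm

omit [IsTopologicalGroup G] in
/-- Unfolding `powPairing`: `⟨x, k⟩ = k • x`. [cite: MochizukiFrdII2008, Def 2.2 (ii) p.18] -/
theorem ContPairing.powPairing_toLin (ρ : ContinuousRep G ℤ M) (hM : ∀ x : M, n • x = 0)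
    (x : M) (k : ZMod n) :
    (ContPairing.powPairing n ρ hM).toLin x k =
      (letI : Module (ZMod n) M := AddCommGroup.zmodModule hM; k • x) := rfl

omit [IsTopologicalGroup G] in
/-- Any additive map between `n`-torsion modules commutes with the power pairings
(`f (k • x) = k • f x`, i.e. `f(ζᵏ) = f(ζ)ᵏ`). [cite: MochizukiFrdII2008, Def 2.2 (ii) p.18] -/
theorem ContPairing.map_powPairing_toLin {G' : Type} [Group G'] [TopologicalSpace G']
    {M' : Type} [AddCommGroup M'] [TopologicalSpace M'] [DiscreteTopology M']
    (ρ : ContinuousRep G ℤ M) (hM : ∀ x : M, n • x = 0)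
    (ρ' : ContinuousRep G' ℤ M') (hM' : ∀ x : M', n • x = 0)
    (f : M →+ M') (x : M) (k : ZMod n) :
    f ((ContPairing.powPairing n ρ hM).toLin x k) =
      (ContPairing.powPairing n ρ' hM').toLin (f x) k := by
  letI : Module (ZMod n) M := AddCommGroup.zmodModule hM
  letI : Module (ZMod n) M' := AddCommGroup.zmodModule hM'
  rw [ContPairing.powPairing_toLin, ContPairing.powPairing_toLin]
  exact ZMod.map_smul f k x

end Pow

section Local

open DiscreteGaloisModule Field

/-- `μ_n(F̄)` is killed by `n` (`ζⁿ = 1`). [cite: SerreGaloisCohomology1997, II §1.2] -/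
theorem MuCarrier.nsmul_eq_zero' (F : Type) [Field F] (n : ℕ) (ζ : MuCarrier F n) : n • ζ = 0 := by
  apply (MuCarrier.toAdditive (K := F) (n := n)).injective
  rw [map_nsmul, map_zero]
  apply Additive.toMul.injective
  rw [toMul_nsmul, toMul_zero]
  exact Subtype.ext ((mem_rootsOfUnity n _).mp (Additive.toMul (MuCarrier.toAdditive ζ)).2)

/-- `ℤ/n` is killed by `n`. [folklore] -/
private theorem ZMod.nsmul_self_eq_zero (n : ℕ) (k : ZMod n) : n • k = 0 := by
  rw [nsmul_eq_mul, ZMod.natCast_self, zero_mul]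


/-- The coefficient isomorphism `Hom(ℤ/n, μ_n) ⥲ μ_n`, `f ↦ f 1` (with inverse `ζ ↦ (k ↦ ζᵏ)`),
as an isomorphism of topological `Γ_F`-modules (`ℤ/n` with the trivial action, so
`(σ f)(1) = σ (f 1)`). [cite: SerreGaloisCohomology1997, II §5.2] -/
def homZModMuIso (F : Type) [Field F] (n : ℕ) [NeZero n] :
    ((ContinuousRep.trivial (absoluteGaloisGroup F) ℤ (ZMod n)).homRep (mu F n)).toTopRep ≅
      (mu F n).toTopRep :=
  letI : Module (ZMod n) (MuCarrier F n) := AddCommGroup.zmodModule (MuCarrier.nsmul_eq_zero' F n)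
  topRepIsoOfEquiv
    { toFun := fun f => f 1
      invFun := fun ζ =>
        { toFun := fun k => k • ζ
          map_zero' := zero_smul _ _
          map_add' := fun a b => add_smul a b ζ }
      map_add' := fun f g => rfl
      map_smul' := fun c f => rfl
      left_inv := fun f => by
        refine HomCarrier.ext fun k => ?_
        change k • f 1 = f k
        rw [← ZMod.map_smul f k (1 : ZMod n), smul_eq_mul, mul_one]
      right_inv := fun ζ => one_smul _ _
      continuous_toFun := continuous_of_discreteTopology
      continuous_invFun := continuous_of_discreteTopology }
    fun g f => by
      change ((ContinuousRep.trivial (absoluteGaloisGroup F) ℤ (ZMod n)).homRep (mu F n)) g f 1 =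
        mu F n g (f 1)
      rw [ContinuousRep.homRep_apply_apply_apply, ContinuousRep.trivial_apply]

/-- Unfolding `homZModMuIso`: the map is `f ↦ f 1`. [cite: SerreGaloisCohomology1997, II §5.2] -/
@[simp] theorem homZModMuIso_hom_apply (F : Type) [Field F] (n : ℕ) [NeZero n]
    (f : HomCarrier (ZMod n) (MuCarrier F n)) : (homZModMuIso F n).hom.hom f = f 1 := rfl

variable (F : Type) [Field F] [ValuativeRel F] [TopologicalSpace F] [IsNonarchimedeanLocalField F]
  [CharZero F] (n : ℕ) [NeZero n]

/-- **Local Tate duality in the adjoint power-pairing form**: for a non-archimedean local field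
`F` of characteristic `0` and `n ≥ 1`, the adjoint `a ↦ (b ↦ a ∪ b)` of the cup product
`H¹(Γ_F, μ_n) × H¹(Γ_F, ℤ/n) → H²(Γ_F, μ_n)` for the pairing `(ζ, k) ↦ ζᵏ` is bijective
(FrdII p. 18 "the cup product … determines an isomorphism `H¹(H, μ_N) ⥲ H^ab ⊗ H²(H, μ_N)`",
[NSW 7.2.6]). From the trunk's `localDuality_bijective` for `M = ℤ/n` (both adjoints of
`(a, b) ↦ ι(a ∪ b)` on `H¹(ℤ/n) × H¹(Hom(ℤ/n, μ_n))` bijective, `ι` injective) via `f ↦ f 1` and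
`a ∪ b = -(b ∪' a)`. [cite: SerreGaloisCohomology1997, II §5.2 Thm. 2] -/
theorem powAdjoint_bijective_local :
    Bijective (fun x : continuousCohomology 1 (mu F n).toTopRep =>
      ((ContPairing.powPairing n (mu F n) (MuCarrier.nsmul_eq_zero' F n)).cupProduct
        x).toAddMonoidHom) := by
  classical
  set ρ := ContinuousRep.trivial (absoluteGaloisGroup F) ℤ (ZMod n) with hρ
  obtain ⟨ι, hι, -, hflip⟩ := localDuality_bijective F ρ (ZMod.nsmul_self_eq_zero n)
  set P := ρ.evalPairing (mu F n) with hP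
  set P₂ := ContPairing.powPairing n (mu F n) (MuCarrier.nsmul_eq_zero' F n) with hP₂
  set κ := homZModMuIso F n with hκ
  -- the coefficient transport `e₁ : H¹(Hom(ℤ/n, μ_n)) ≃ H¹(μ_n)` along `f ↦ f 1`
  let e₁ := continuousCohomologyEquivOfIso κ 1
  -- key identity: `(e₁ b) ∪₂ a = b ∪' a = -(a ∪ b)`
  have key : ∀ (b : continuousCohomology 1 (ρ.homRep (mu F n)).toTopRep)
      (a : continuousCohomology 1 ρ.toTopRep),
      P₂.cupProduct (e₁ b) a = -P.cupProduct a b := by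
    intro b a
    have h1 := ContPairing.cupProduct_map P.flip P₂ κ.hom (𝟙 _) (𝟙 _) (fun f m => by
      change f m = P₂.toLin (f 1) m
      rw [ContPairing.powPairing_toLin]
      letI : Module (ZMod n) (MuCarrier F n) :=
        AddCommGroup.zmodModule (MuCarrier.nsmul_eq_zero' F n)
      change f m = m • f 1
      rw [← ZMod.map_smul f m (1 : ZMod n), smul_eq_mul, mul_one]) b a
    rw [show ∀ z, cohomologyMap (𝟙 (mu F n).toTopRep) 2 z = z from
        fun z => map_apply_of_id _ (fun _ => rfl) _ (fun _ => rfl) 2 z,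
      show cohomologyMap (𝟙 ρ.toTopRep) 1 a = a from
        map_apply_of_id _ (fun _ => rfl) _ (fun _ => rfl) 1 a] at h1
    rw [ContPairing.cupProduct_comm P a b, neg_neg]
    exact h1.symm
  have keyι : ∀ (b : continuousCohomology 1 (ρ.homRep (mu F n)).toTopRep)
      (a : continuousCohomology 1 ρ.toTopRep),
      ι (P₂.cupProduct (e₁ b) a) = -(ρ.dualityPairing (mu F n) ι).flip b a := by
    intro b a
    rw [key, map_neg, AddMonoidHom.flip_apply, ContinuousRep.dualityPairing_apply]
  constructor
  · intro x x' hxx'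
    obtain ⟨b, rfl⟩ := e₁.surjective x
    obtain ⟨b', rfl⟩ := e₁.surjective x'
    have hb : (ρ.dualityPairing (mu F n) ι).flip b = (ρ.dualityPairing (mu F n) ι).flip b' := by
      ext a
      have h := congrArg (fun φ : continuousCohomology 1 ρ.toTopRep →+ _ => ι (φ a)) hxx'
      change ι ((P₂.cupProduct (e₁ b)).toAddMonoidHom a) =
        ι ((P₂.cupProduct (e₁ b')).toAddMonoidHom a) at h
      rw [LinearMap.toAddMonoidHom_coe, LinearMap.toAddMonoidHom_coe, keyι, keyι, neg_inj] at h
      exact h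
    rw [hflip.1 hb]
  · intro φ
    obtain ⟨b, hb⟩ := hflip.2 (-(ι.comp φ))
    refine ⟨e₁ b, AddMonoidHom.ext fun a => hι ?_⟩
    rw [LinearMap.toAddMonoidHom_coe, keyι, hb, AddMonoidHom.neg_apply, neg_neg,
      AddMonoidHom.comp_apply]

end Local

end Literature.NumberTheory.GaloisRepresentations

end
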